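import Literature.MathematicalPhysics.QuantumFieldTheory.Balaban1983to89.Beta.RemainderLocality
import Literature.MathematicalPhysics.QuantumFieldTheory.Balaban1983to89.B12Decay510FromB11

/-!
# [Balaban1987RG1] p. 282 ⟵ [Balaban1985Variational] (190): the decay leaf `hh` of the torus remainder chain DERIVED
from the tree's typed (190) + (2.61) + the (4.4)-dictionary (`Beta.RemainderDecay190`)

HONEST FRAMING (cell rule, page 1 of everything).  Discharging `BetaPertH` makes Bałaban's UV stability UNCONDITIONAL —
a real constructive-QFT result; it is NOT the continuum limit and NOT the Clay problem.  This module discharges NOTHING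
of `BetaPertH`; it replaces ONE located leaf of the k-uniform remainder chain (the wall's item (D4): `RemainderConst` ⇐
the (β) leaves of [II]'s cluster expansion and [I] §§4–5 AS PRINTED) — the p. 282 decay `hh` of the (4.35) test vectors,
which [I] states BY REFERENCE to *"Sect. G [15]"* — by the published inequality it refers to, (190) of [15], as ALREADY
TYPED in the tree (`B11SectG.Ineq190`), the row sum (2.61) of [3] (`B11SectG.RowSum`) and the (4.4)-dictionary of
`B12Decay510FromB11` (unit b03-g4), and derives `hh` from them in the kernel on the PERIODIC carrier of the an4 chain.
Bookkeeping-grade (a by-name conversion of a located leaf into typed printed inputs); NOT summit progress.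

ABSOLUTE RULE (cell).  "No internally-minted statement may enter as a cited fact. Every hypothesis is either
kernel-proved in this package or a verbatim quotation of a PUBLISHED theorem with page reference. The manuscript(s)
under audit are NOT citable for their own disputed steps — they are the thing under adjudication; programme-internal
(2001/route/tribunal) claims are never citable."  Every `def` below is a definition, a hypothesis STRUCTURE (whose
fields are displayed hypotheses, never facts), or a proved theorem.

CITATION HEADER (lean-in-tree rule 2026-08-18).  [I] = T. Bałaban, *Renormalization group approach to lattice gauge field
theories. I. Generation of effective actions in a small field approximation and a coupling constant renormalization in
four dimensions*, Commun. Math. Phys. **109**, 249–301 (1987) [Balaban1987RG1] (held `paper:balaban1987-cmp109-rg-i-small-field`;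
PDF page = journal page − 248); [15] = T. Bałaban, *The variational problem and background fields in renormalization group
method for lattice gauge theories*, Commun. Math. Phys. **102**, 277–309 (1985) [Balaban1985Variational] (held
`paper:balaban1985-cmp102-variational-background`; PDF page = journal page − 276); [3] = T. Bałaban, *Propagators and
renormalization transformations for lattice gauge theories. II*, Commun. Math. Phys. **96**, 223–250 (1984)
[Balaban1984PropagatorsII] (PDF page = journal page − 222); [II] = T. Bałaban, *Renormalization group approach to lattice
gauge field theories. II. Cluster expansions*, Commun. Math. Phys. **116**, 1–22 (1988) [Balaban1988RG2Cluster].  The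
three quotations below were RE-READ FOR THIS MODULE on the 300-dpi renders
`HOME/b2b-balaban-ref1/pages/1987-cmp109-rg-I-small-field/…-p034-x2.png` ([I] p. 282),
`…/1985-cmp102-variational-background/…-p032-x2.png` ([15] p. 308) and `…/1984-cmp96-propagators-rt-II/…-p012-x2.png`
([3] p. 234) (unit `b2b-balaban-beta-an4-g12`, 2026-08-19); they agree letter for letter with the wordings certified in
`B12Decay510FromB11` (unit b03-g4) and `B12Ineq45` (unit pv12).  Satellite of `Beta.RemainderChainTorus` /
`Beta.RemainderLimitTorus` / `Beta.RemainderLocality` (the an4 chain on the periodic carrier, units an4 gens 8–11) and of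
`B12Decay510FromB11` (the same discharge for b03's `B12Decay510` family and window forms).

## The located leaf and the printed statements it cites

(L) THE LEAF.  The field `hh` of the three torus leaf lists `RemainderChainTorus.PolLeavesT`, `RemainderLimitTorus.PolLeavesTLoc`,
`RemainderLocality.PolLeavesTFac`: `‖h_n(X̄, x)‖ ≤ B₃ · e^{−δ₀ · dist_T(x, X̄)}`, dist_T the periodic ℓ¹ distance from the
site x (torus with N_n·M sites per direction) to the nearest cube of the localization domain X̄
(`B12Decay510Torus.distCT … (nearT x X̄)`), `h_n(X̄, x)` the (4.35) test vector = the restricted linearized minimizer in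
the direction of the unit source field at x.  Typed (an4 gen 8, following b03-g3's `B12Decay510`) from [I] p. 282 [PDF 34],
verbatim: *"The functional derivative (δ^{n(p)})/(δB^{n(p)})𝐇_j(□₀, 0) is given by a sum of several perturbative
expressions discussed in Sect. G [15]. Each expression corresponds to a tree graph with n(p) initial points and one
final point, and it has an exponential decay in a length of this graph. The derivative has an exponential decay in a
length of a shortest tree graph of this type. The norm in (4.4) of the expression ⟨(δ^{n(p)}/δB^{n(p)})𝐇_j(□₀, 0),
⊗_{i∈N(p)}B_i⟩ can be estimated by B₃∏_{i∈N(p)}∣B_i∣, and if one of the functions B_i is localized outside the domain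
X, then we have the additional exponential factor exp(−δ₀dist^{(ξ)}(X, supp B_i))."* — for (4.35) only the block
n(p) = 1 enters; B₃ and this δ₀ are not defined in [I]; the bound is BY REFERENCE, no statement number (cell GAPS
G-b03g3-1 (2)(a); an4 census `REMAINDER-BETA.md` §6 row `hh`: LOCATED).

(P1) [15] (190) p. 308 [PDF 32], verbatim: *"This inequality, the formula (188) and Lemma 2.1, and finally Proposition 2
and (181), yield ∣(δ/δB_ν(y′))𝓗_μ(B,x)∣, ∣∇_x(δ/δB_ν(y′))𝓗_μ(B,x)∣, ‖ζ∇(δ/δB(y′))𝓗(B)‖_β,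
∣D^{η*}_{U_k}D^η_{U_k}(δ/δB_ν(y))𝓗_μ(B,x)∣, ∣Δ^η_{U_k}(δ/δB_ν(y′))𝓗_μ(B,x)∣ ≤ O(1)[(L^jη)^{−1}, (L^jη)^{−2},
(‖ζ‖^#_β + ∣ζ∣)(L^jη)^{−2−β}, (L^jη)^{−3}, (L^jη)^{−3}]·(L^{j′}η)^{−d} exp(−⅛δ₀d(y,y′)) (190) for x ∈ Δ(y), or
supp ζ ⊂ Δ̃(y), y ∈ Λ_j, y′ ∈ Λ_{j′}."*  In the tree: the NAMED HYPOTHESIS `B11SectG.Ineq190 bB bout dH C δ₀` (δ𝓗 has the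
block majorant C·e^{−⅛δ₀d(y,y′)} from the B-size `bB` into the local size `bout`, one entry per local size, the scale
weights inside the sizes), derived from (189) and the printed leaves by `B11SectG.ineq190_of_189` (cell GAPS C-B11-G2aK;
the words *"and finally Proposition 2 and (181)"* not typed — G-B11-G2a).

(P2) [3] Lemma 2.1 (2.61) p. 234 [PDF 12], verbatim: *"Lemma 2.1. For the numbers α, 0 < α < 1, c₁(α) = 12c₀^d(½α), and
RM satisfying (2.59) we have … sup_{y∈𝔅} Σ_{y′∈𝔅} e^{−αδ₀d(y,y′)} ≤ c₁(α), (2.61)"*.  In the tree: the hypothesis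
`B11SectG.RowSum g σ c` (= `B6RandomWalk.Ineq261` at σ = αδ₀, c = c₁(α), `B11SectG.rowSum_iff_ineq261`).

(D) THE DICTIONARY of `B12Decay510FromB11` (cell DIVERGENCE D-b03.12): `NormDominated` — the (4.4)-functional of X̄
([I] (4.4) p. 281: *"max{∣𝐀∣_X, ∣P₁(□₀)𝐀∣_X, ∣∇^ξ𝐀∣_X, ∣Δ^ξ𝐀∣_X} < α₂"*, sup-norms over X of local quantities) is
dominated by the local sizes of (190) over the blocks of 𝔅 meeting X̄ (the literal "max over i and y ∈ blk X̄" reading,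
`B12Decay510FromB11.normDominated_of_le_supLoc`); `UnitFieldsLocalised` — p. 282's *"B_i is localized outside the
domain X"* with *"dist^{(ξ)}(X, supp B_i)"* converted into the multiscale distance d(y, y′) of (190) by a factor θ; and
the B-size of the unit source fields u(x) = δ_{(x,μ)} of (4.35)/(5.1) bounded by m (p. 282's *"∏∣B_i∣"*).

## What is PROVED here (kernel-checked; every input a NAMED hypothesis field, nothing asserted)

(K1) `Data190.norm_hn_le_rate`, `Data190.hh` — b03-g4's `B12Decay510FromB11.norm_dH_le` ((190) block by block via pv12's
`B12Ineq45.loc_dH_le_of_ineq190_localised`, then the domination) instantiated AT THE TORUS SITE GEOMETRY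
`B12Decay510Torus.geomT d (N n) M`, whose distance-to-a-domain IS BY DEFINITION the periodic ℓ¹ distance to the nearest
cube used by the field `hh` (definitional unfolding, no lemma), then κ_B ≤ κ̄_B and the rate monotonicity δ₀ ≤ τθ:
for the test vectors GENERATED by the data, `h_n(X̄, x) := ι_X̄((δ𝐇_j(□₀,0)/δB) u(x))` (`Data190.hn`),
‖h_n(X̄, x)‖ ≤ Cκ̄_Bcm · e^{−δ₀·dist_T(x, X̄)} — the field `hh` LITERALLY, with B₃ := Cκ̄_Bcm (`Consts190.B₃`).
(K2) The leaf lists `PolLeavesT190` / `PolLeavesTLoc190` / `PolLeavesTFac190` = the three originals with the fields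
(`hn`, `hh`) replaced by the (190)-side data `D : Data190` (the (4.35) representation `hrepr` and the (F2) limits `hconv`
read on `D.hn`), and the maps `toPolLeavesT`, `toPolLeavesTLoc`, `toPolLeavesTFac`; the chains `ChainT190` / `ChainTFac190`
↦ `ChainT` / `ChainTFac`; hence the k-UNIFORM REMAINDER BOUND with the SAME closed coefficient at B₃ := Cκ̄_Bcm —
`ChainT190.abs_beta1_le`, `ChainTFac190.abs_beta1_le : … → RemainderConst S γ (c.ε₁ · remCoeffL d M c α₂ (Cκ̄_Bcm))`
LITERALLY (the wall's remainder slot `(hrem : RemainderConst S γ₀ rr)`), the one-sided forms, the sign record assembled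
from the printed signs (`Consts190.Valid.signsL`, B₃ ≥ 0 derived), and the RULING (R10) END consumers by name
(`betaPartialSumsLowerH_of_telescope_chainTFac190`, `endpointExistence_of_telescope_chainTFac190`,
`endpointExistence_of_telescope_chainT190`).

## Effect on the (β) leaf census (wall item (D4); `REMAINDER-BETA.md` §6)

Row `hh` ([I] p. 282, located by reference) ↦ DERIVED from (P1) + (P2) + (D).  The residual on this row is (190)'s own
located inputs (G-B11-G2a and the printed leaves of `B11SectG`), the row sum (2.61), and the three dictionary hypotheses
(D) — i.e. on this leaf the an4 chain's [I]-side ledger now COINCIDES with b03's (census row G-B12s-15 of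
`B12Decay510FromB11`, there for the family / window forms of `B12Decay510`; here for the end-to-end periodic chain feeding
`RemainderConst`).  Every OTHER row is unchanged: analyticity on the (4.4)-ball `han`, the (4.35) representation `hrepr`,
the (4.4) seam `hemb`/`hcomp`, [II] Lemma 3 (2.38)_ℓ `h238`, (2.13) `hrep`, p. 15 `hsp`, and (5.1) `hlim` / termwise
locality `hloc` / (F1) `hfac` + (F2) `hconv`.

## What is NOT claimed

* (190) is NOT proved here (field `h190`), nor (2.61) (`hrow`), nor the dictionary (D) (`hdom`, `hm`, `hD`); the higher
  blocks n(p) ≥ 2 of the p. 282 sentence (tree graphs of [15] Sect. G) are not touched — they do not enter (4.35).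
* B12's δ₀.  [I] prints ONE generic δ₀ on p. 282 and in (5.10); the kernel statement holds for EVERY δ₀ ≤ τθ with
  σ + τ ≤ ⅛δ₀^{[15]} (`Consts190.Valid.rate`, `.στ`) — a reading (cell DIVERGENCE D-b03.12 (i), cell GAPS G-IF-06),
  recorded not resolved.  In the an4 chain δ₀ is the field `c.δ₀` of the [II]-constant record `B13.Consts`, so
  `q.Valid c.δ₀` is the displayed compatibility clause "the record's δ₀ does not exceed the rate (190) + (2.61) deliver
  through the conversion factor θ".
* The (190)-constant record `q : Consts190` is ONE for all scales k, histories p and volumes n (fields of `ChainT190` /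
  `ChainTFac190`): the uniformity of [15]'s constants in the step is thereby DISPLAYED as a hypothesis shape, not proved.
* No `Literature` fact is minted; no `axiom`, no `sorry`.  NOT summit progress, NOT the continuum limit, NOT Clay.
-/

namespace Literature.MathematicalPhysics.QuantumFieldTheory.Balaban1983to89.Beta.RemainderDecay190

open Literature.MathematicalPhysics.QuantumFieldTheory.Balaban1983to89
open FlowStep DagBinding FlowStepRuns
open Literature.MathematicalPhysics.QuantumFieldTheory.Balaban1983to89.B11SectG (BlockNorm Ineq190 RowSum)
open Literature.MathematicalPhysics.QuantumFieldTheory.Balaban1983to89.B12Decay510FromB11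
  (NormDominated UnitFieldsLocalised norm_dH_le)
open Literature.MathematicalPhysics.QuantumFieldTheory.Balaban1983to89.B13ScaleTransfer (Pt)
open Literature.MathematicalPhysics.QuantumFieldTheory.Balaban1983to89.B13Resummation (SpRestr Repr213)
open Literature.MathematicalPhysics.QuantumFieldTheory.Balaban1983to89.TreeLengthTorus (TPt TDom proj tsys)
open Literature.MathematicalPhysics.QuantumFieldTheory.Balaban1983to89.TreeLengthTorusGeometry (TorusStep)
open Literature.MathematicalPhysics.QuantumFieldTheory.Balaban1983to89.B12Decay510 (mixedDeriv)
open Literature.MathematicalPhysics.QuantumFieldTheory.Balaban1983to89.B12Decay510Torus (distCT nearT geomT distCT_nonneg)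
open Literature.MathematicalPhysics.QuantumFieldTheory.Balaban1983to89.Beta.RemainderChain
open Literature.MathematicalPhysics.QuantumFieldTheory.Balaban1983to89.Beta.RemainderChainLattice
  (CondsL SignsL remCoeffL)
open Literature.MathematicalPhysics.QuantumFieldTheory.Balaban1983to89.Beta.RemainderChainTorus
  (PolLeavesT ChainT betaPartialSumsLowerH_of_telescope_chainT endpointExistence_of_telescope_chainT)
open Literature.MathematicalPhysics.QuantumFieldTheory.Balaban1983to89.Beta.RemainderLimitTorus
  (LDom tproj limKernel PolLeavesTLoc ChainTLoc)
open Literature.MathematicalPhysics.QuantumFieldTheory.Balaban1983to89.Beta.RemainderLocality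
  (PolLeavesTFac ChainTFac betaPartialSumsLowerH_of_telescope_chainTFac endpointExistence_of_telescope_chainTFac)
open Metric Filter Topology

noncomputable section

variable {d : ℕ}

/-! ## 1. The constants of the [15]/[3] side and the derived B₃ = C κ̄_B c m -/

/-- The constants of the (190)-side data, ALL UNIFORM IN THE VOLUME, THE SCALE AND THE HISTORY: `Cst` = the O(1) of
(190); `δ15` = the δ₀ OF [15] (the rate of (190) is ⅛δ₀); `σ` = the rate at which the row sum (2.61) is used and `cR` =
its constant c₁(·); `τ` = the part of the rate budget ⅛δ₀^{[15]} − σ spent on the decay; `m` ≥ the B-size of the unit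
source fields; `θ` = the (unprinted) conversion factor between dist^{(ξ)}(X, supp B_i) of [I] p. 282 and the multiscale
distance d(y, y′) of [3] (2.46) (cell DIVERGENCE D-b03.12 (i)); `κB` ≥ the cutting constants κ_B of the B-sizes.
[cite: Balaban1985Variational, (190) p.308; Balaban1984PropagatorsII, (2.61) p.234; Balaban1987RG1, p.282] -/
structure Consts190 where
  /-- the O(1) constant C of (190) -/
  Cst : ℝ
  /-- δ₀ of [15]: the rate of (190) is ⅛δ₀ -/
  δ15 : ℝ
  /-- the rate σ at which (2.61) is used -/
  σ : ℝ
  /-- the decay part τ of the rate budget -/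
  τ : ℝ
  /-- the row-sum constant c = c₁(·) of (2.61) -/
  cR : ℝ
  /-- a bound m of the B-size of the unit source fields -/
  m : ℝ
  /-- the conversion factor θ between dist^{(ξ)} and d(y, y′) -/
  θ : ℝ
  /-- a uniform bound κ̄_B of the cutting constants of the B-sizes -/
  κB : ℝ

namespace Consts190

/-- **B₃ := C · κ̄_B · c · m** — the constant of the p. 282 sentence *"can be estimated by B₃∏∣B_i∣"* as DELIVERED by
(190) + (2.61) (`B12Decay510FromB11.norm_dH_le`), uniformised over the cutting constants.
[cite: Balaban1987RG1, p.282; Balaban1985Variational, (190) p.308] -/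
def B₃ (q : Consts190) : ℝ := q.Cst * q.κB * q.cR * q.m

/-- The printed signs and the rate budget under which (190) + (2.61) give the p. 282 decay AT RATE δ₀ (B12's generic
δ₀, here the argument): C ≥ 0, c ≥ 0, m ≥ 0, κ̄_B ≥ 0, τ ≥ 0, σ + τ ≤ ⅛δ₀^{[15]}, and δ₀ ≤ τθ (B12's δ₀ is any rate not
exceeding τθ — cell DIVERGENCE D-b03.12 (i), cell GAPS G-IF-06). [cite: Balaban1985Variational, (190) p.308; Balaban1987RG1, (5.10) p.293] -/
structure Valid (q : Consts190) (δ₀ : ℝ) : Prop where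
  Cst : 0 ≤ q.Cst
  cR : 0 ≤ q.cR
  m : 0 ≤ q.m
  κB : 0 ≤ q.κB
  τ : 0 ≤ q.τ
  στ : q.σ + q.τ ≤ q.δ15 / 8
  rate : δ₀ ≤ q.τ * q.θ

/-- B₃ = Cκ̄_Bcm ≥ 0 under the signs. [folklore] -/
theorem Valid.B₃_nonneg {q : Consts190} {δ₀ : ℝ} (hq : q.Valid δ₀) : 0 ≤ q.B₃ :=
  mul_nonneg (mul_nonneg (mul_nonneg hq.Cst hq.κB) hq.cR) hq.m

/-- The sign record `RemainderChainLattice.SignsL c α₂ B₃` of the an4 chain at B₃ := Cκ̄_Bcm, from the remaining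
printed signs (C₃ε₁ ≥ 0, α₂ > 0, δ₀ > 0). [folklore] -/
theorem Valid.signsL {q : Consts190} {c : B13.Consts} (hq : q.Valid c.δ₀) (hA : 0 ≤ c.C3act * c.ε₁) {α₂ : ℝ}
    (hα₂ : 0 < α₂) (hδ₀ : 0 < c.δ₀) : SignsL c α₂ q.B₃ :=
  ⟨hA, hα₂, hq.B₃_nonneg, hδ₀⟩

end Consts190

/-! ## 2. The (190)-side data on the exhausting tori and the DERIVED decay `hh` -/

/-- **THE [15]/[3]-SIDE DATA ON THE EXHAUSTING TORI** replacing the located leaf `hh` of the torus leaf lists: for each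
torus index n — a multiscale geometry 𝔅_n (`B6.Geometry`), the real spaces of B-data and of configurations with the
B-size `bBn n` and the local sizes `boutn n i` (i over the sizes entering the (4.4)-functional), the first B-derivative
`dHn n` = δ𝐇_j(□₀, 0)/δB of the restricted minimizer WITH (190) (`h190`: block majorant C e^{−⅛δ₀^{[15]} d(y,y′)}`,
`B11SectG.Ineq190`), the row sum (2.61) (`hrow`, `B11SectG.RowSum`), non-negative multiscale distances (`hdist`),
cutting constants ≤ κ̄_B (`hκB`); and the DICTIONARY of `B12Decay510FromB11`: the blocks `blkn n X̄` meeting a torus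
localization domain X̄, the identification `ιn n X̄` of the real configurations with the complex (4.4)-space `Wn n`
DOMINATED by the local sizes over those blocks (`hdom`, `NormDominated`), the unit source fields `un n x` (x a site of the
torus with N_n·M sites per direction) of B-size ≤ m (`hm`) and LOCALISED with conversion factor θ in the torus site
geometry `B12Decay510Torus.geomT` (`hD`, `UnitFieldsLocalised`: dist(x, X̄) = the periodic ℓ¹ distance from x to the
nearest cube of X̄).  A HYPOTHESIS structure: nothing of it is discharged here; its constants are the volume-, scale- and
history-uniform `q : Consts190`. [cite: Balaban1985Variational, (190) p.308; Balaban1984PropagatorsII, (2.61) p.234; Balaban1987RG1, (4.4) p.281 and p.282] -/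
structure Data190 (d M : ℕ) [NeZero M] (N : ℕ → ℕ) [∀ n, NeZero (N n)] (Wn : ℕ → Type)
    [∀ n, NormedAddCommGroup (Wn n)] (q : Consts190) where
  I : Type
  gn : ℕ → B6.Geometry
  FBn : ℕ → Type
  FAn : ℕ → Type
  [instFB : ∀ n, AddCommGroup (FBn n)]
  [instFBm : ∀ n, Module ℝ (FBn n)]
  [instFA : ∀ n, AddCommGroup (FAn n)]
  [instFAm : ∀ n, Module ℝ (FAn n)]
  bBn : (n : ℕ) → BlockNorm (gn n) (FBn n)
  boutn : (n : ℕ) → I → BlockNorm (gn n) (FAn n)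
  dHn : (n : ℕ) → FBn n →ₗ[ℝ] FAn n
  blkn : (n : ℕ) → TDom d (N n) → Finset (gn n).Site
  ιn : (n : ℕ) → TDom d (N n) → FAn n → Wn n
  un : (n : ℕ) → TPt d (N n * M) → FBn n
  h190 : ∀ n i, Ineq190 (bBn n) (boutn n i) (dHn n) q.Cst q.δ15
  hdist : ∀ n (a b : (gn n).Site), 0 ≤ (gn n).dist a b
  hrow : ∀ n, RowSum (gn n) q.σ q.cR
  hκB : ∀ n, (bBn n).κ ≤ q.κB
  hdom : ∀ n, NormDominated (S := tsys d (N n)) (boutn n) (blkn n) (V := fun _ => Wn n) (ιn n)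
  hm : ∀ n x y', (bBn n).loc y' (un n x) ≤ q.m
  hD : ∀ n, UnitFieldsLocalised (bBn n) (geomT d (N n) M) (blkn n) (un n) q.θ

namespace Data190

variable {M : ℕ} [NeZero M] {N : ℕ → ℕ} [∀ n, NeZero (N n)] {Wn : ℕ → Type} [∀ n, NormedAddCommGroup (Wn n)]
  {q : Consts190} (D : Data190 d M N Wn q)

/-- The carried additive-group structures of the spaces of B-data. [folklore] -/
instance instAddCommGroupFB (n : ℕ) : AddCommGroup (D.FBn n) := D.instFB n

/-- The carried real-module structures of the spaces of B-data. [folklore] -/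
instance instModuleFB (n : ℕ) : Module ℝ (D.FBn n) := D.instFBm n

/-- The carried additive-group structures of the configuration spaces. [folklore] -/
instance instAddCommGroupFA (n : ℕ) : AddCommGroup (D.FAn n) := D.instFA n

/-- The carried real-module structures of the configuration spaces. [folklore] -/
instance instModuleFA (n : ℕ) : Module ℝ (D.FAn n) := D.instFAm n

/-- **The (4.35) test vectors generated by the data**: h_n(X̄, x) := ι_X̄((δ𝐇_j(□₀,0)/δB) u(x)) — the restricted
linearized minimizer in the direction of the unit source field at the site x, read in the (4.4)-space of X̄.
[cite: Balaban1987RG1, (4.35) p.290 and p.282] -/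
def hn (n : ℕ) (X : TDom d (N n)) (x : TPt d (N n * M)) : Wn n := D.ιn n X (D.dHn n (D.un n x))

/-- **The p. 282 decay AT THE KERNEL RATE τθ, DERIVED** (`B12Decay510FromB11.norm_dH_le` at the torus site geometry
`geomT`, then κ_B ≤ κ̄_B): ‖h_n(X̄, x)‖ ≤ Cκ̄_Bcm · e^{−τθ·dist_T(x, X̄)}, dist_T the periodic ℓ¹ distance from the site x to
the nearest cube of X̄. [cite: Balaban1987RG1, p.282; Balaban1985Variational, (190) p.308; Balaban1984PropagatorsII, (2.61) p.234] -/
theorem norm_hn_le_rate {δ₀ : ℝ} (hq : q.Valid δ₀) (n : ℕ) (X : TDom d (N n)) (x : TPt d (N n * M)) :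
    ‖D.hn n X x‖ ≤ q.B₃ * Real.exp (-(q.τ * q.θ) * distCT (N n) M x (nearT (M := M) x X)) := by
  show ‖D.ιn n X (D.dHn n (D.un n x))‖ ≤ _
  have h1 := norm_dH_le (D.bBn n) (D.boutn n) (D.dHn n) (D.h190 n) hq.Cst (D.hdist n) (D.hrow n) hq.cR hq.τ hq.στ
    (geomT d (N n) M) (D.blkn n) (V := fun _ => Wn n) (D.hdom n) hq.m (D.hm n) (D.hD n) X x
  have h2 : q.Cst * (D.bBn n).κ * q.cR * q.m ≤ q.B₃ :=
    mul_le_mul_of_nonneg_right (mul_le_mul_of_nonneg_right (mul_le_mul_of_nonneg_left (D.hκB n) hq.Cst) hq.cR) hq.m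
  exact h1.trans (mul_le_mul_of_nonneg_right h2 (Real.exp_nonneg _))

/-- **THE LEAF `hh` OF THE TORUS LEAF LISTS, DERIVED**: for every rate δ₀ ≤ τθ,
‖h_n(X̄, x)‖ ≤ B₃ · e^{−δ₀·dist_T(x, X̄)} with B₃ = Cκ̄_Bcm — literally the field `hh` of `RemainderChainTorus.PolLeavesT` /
`RemainderLimitTorus.PolLeavesTLoc` / `RemainderLocality.PolLeavesTFac` at `hn := D.hn`, `B₃ := q.B₃`.
[cite: Balaban1987RG1, p.282; Balaban1985Variational, (190) p.308; Balaban1984PropagatorsII, (2.61) p.234] -/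
theorem hh {δ₀ : ℝ} (hq : q.Valid δ₀) (n : ℕ) (X : TDom d (N n)) (x : TPt d (N n * M)) :
    ‖D.hn n X x‖ ≤ q.B₃ * Real.exp (-δ₀ * distCT (N n) M x (nearT (M := M) x X)) := by
  refine (D.norm_hn_le_rate hq n X x).trans (mul_le_mul_of_nonneg_left ?_ hq.B₃_nonneg)
  exact Real.exp_le_exp.mpr (mul_le_mul_of_nonneg_right (neg_le_neg hq.rate) (distCT_nonneg x _))

end Data190

/-! ## 3. The three torus leaf lists with `hh` replaced by the (190)-side data -/

/-- **`RemainderChainTorus.PolLeavesT` WITH THE p. 282 LEAF REPLACED BY THE (190)-SIDE DATA**: the torus leaf list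
verbatim (exhausting tori, [II]-side step data with the torus catalogues, (2.13), Lemma 3's (2.38)_ℓ, the (4.4) seam,
analyticity on the α₂-ball, the limit (5.1)) EXCEPT the fields `hn`, `hh`: in their place the data `D : Data190` of § 2,
the (4.35) representation `hrepr` being read on the generated test vectors `D.hn`.  A HYPOTHESIS structure.
[cite: Balaban1987RG1, (4.4) p.281, (4.35) p.290, p.282 and (5.1) p.292; Balaban1988RG2Cluster, (2.38) p.20 and (2.13) p.14; Balaban1985Variational, (190) p.308] -/
structure PolLeavesT190 (d M : ℕ) [NeZero M] (P : (Fin d → ℤ) → ℝ) (c : B13.Consts) (ℓ α₂ : ℝ) (q : Consts190) where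
  N : ℕ → ℕ
  [hN : ∀ n, NeZero (N n)]
  hNlim : Tendsto N atTop atTop
  W : (n : ℕ) → TorusStep d (N n)
  hsp : ∀ n, SpRestr (W n).toStepData (W n).geom
  hrep : ∀ n, Repr213 (W n).toStepData (W n).geom
  h238 : ∀ n, B13.Bound238With (W n).toStepData c ℓ
  Wn : ℕ → Type
  [instW : ∀ n, NormedAddCommGroup (Wn n)]
  [instWs : ∀ n, NormedSpace ℂ (Wn n)]
  EXn : (n : ℕ) → TDom d (N n) → Wn n → ℂ
  emb : (n : ℕ) → TDom d (N n) → Wn n → (W n).Φ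
  hemb : ∀ n X, ∀ v ∈ ball (0 : Wn n) α₂, emb n X v ∈ (W n).sp2 X
  hcomp : ∀ n X v, EXn n X v = (W n).Ek1 X (emb n X v)
  D : Data190 d M N Wn q
  E2n : (n : ℕ) → TDom d (N n) → TPt d (N n * M) → TPt d (N n * M) → ℝ
  han : ∀ n X, AnalyticOnNhd ℂ (EXn n X) (ball 0 α₂)
  hrepr : ∀ n X x y, E2n n X x y = (mixedDeriv (EXn n X) (D.hn n X x) (D.hn n X y)).re
  hlim : ∀ z, Tendsto (fun n => ∑ X : TDom d (N n), E2n n X (proj (N n * M) 0) (proj (N n * M) z)) atTop (𝓝 (P z))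

/-- The carried `NeZero (N n)` witnesses. [folklore] -/
instance PolLeavesT190.instNeZeroN {M : ℕ} [NeZero M] {P : (Fin d → ℤ) → ℝ} {c : B13.Consts} {ℓ α₂ : ℝ}
    {q : Consts190} (Lv : PolLeavesT190 d M P c ℓ α₂ q) (n : ℕ) : NeZero (Lv.N n) := Lv.hN n

/-- The carried normed-group structures of the test-vector spaces. [folklore] -/
instance PolLeavesT190.instNormedAddCommGroupWn {M : ℕ} [NeZero M] {P : (Fin d → ℤ) → ℝ} {c : B13.Consts}
    {ℓ α₂ : ℝ} {q : Consts190} (Lv : PolLeavesT190 d M P c ℓ α₂ q) (n : ℕ) : NormedAddCommGroup (Lv.Wn n) :=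
  Lv.instW n

/-- The carried ℂ-normed-space structures of the test-vector spaces. [folklore] -/
instance PolLeavesT190.instNormedSpaceWn {M : ℕ} [NeZero M] {P : (Fin d → ℤ) → ℝ} {c : B13.Consts} {ℓ α₂ : ℝ}
    {q : Consts190} (Lv : PolLeavesT190 d M P c ℓ α₂ q) (n : ℕ) : NormedSpace ℂ (Lv.Wn n) := Lv.instWs n

/-- **The (190)-side data GIVE the torus leaf list of `RemainderChainTorus`** with B₃ := Cκ̄_Bcm, for every rate reading
δ₀ ≤ τθ of the [II]-constant record: `hn := D.hn`, `hh := D.hh` — the p. 282 leaf DERIVED, everything else carried over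
verbatim. [cite: Balaban1987RG1, p.282 and (4.35) p.290; Balaban1985Variational, (190) p.308] -/
def PolLeavesT190.toPolLeavesT {M : ℕ} [NeZero M] {P : (Fin d → ℤ) → ℝ} {c : B13.Consts} {ℓ α₂ : ℝ} {q : Consts190}
    (Lv : PolLeavesT190 d M P c ℓ α₂ q) (hq : q.Valid c.δ₀) : PolLeavesT d M P c ℓ α₂ q.B₃ where
  N := Lv.N
  hN := Lv.hN
  hNlim := Lv.hNlim
  W := Lv.W
  hsp := Lv.hsp
  hrep := Lv.hrep
  h238 := Lv.h238
  Wn := Lv.Wn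
  instW := Lv.instW
  instWs := Lv.instWs
  EXn := Lv.EXn
  emb := Lv.emb
  hemb := Lv.hemb
  hcomp := Lv.hcomp
  hn := Lv.D.hn
  E2n := Lv.E2n
  han := Lv.han
  hrepr := Lv.hrepr
  hh := Lv.D.hh hq
  hlim := Lv.hlim

/-- **`RemainderLimitTorus.PolLeavesTLoc` WITH THE p. 282 LEAF REPLACED BY THE (190)-SIDE DATA** (termwise locality `hloc`
instead of (5.1)). A HYPOTHESIS structure. [cite: Balaban1987RG1, (1.21) p.264, (4.35) p.290 and p.282; Balaban1988RG2Cluster, (2.38) p.20; Balaban1985Variational, (190) p.308] -/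
structure PolLeavesTLoc190 (d M : ℕ) [NeZero M] (a : LDom d → Pt d → ℝ) (c : B13.Consts) (ℓ α₂ : ℝ) (q : Consts190)
    where
  N : ℕ → ℕ
  [hN : ∀ n, NeZero (N n)]
  hNlim : Tendsto N atTop atTop
  W : (n : ℕ) → TorusStep d (N n)
  hsp : ∀ n, SpRestr (W n).toStepData (W n).geom
  hrep : ∀ n, Repr213 (W n).toStepData (W n).geom
  h238 : ∀ n, B13.Bound238With (W n).toStepData c ℓ
  Wn : ℕ → Type
  [instW : ∀ n, NormedAddCommGroup (Wn n)]
  [instWs : ∀ n, NormedSpace ℂ (Wn n)]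
  EXn : (n : ℕ) → TDom d (N n) → Wn n → ℂ
  emb : (n : ℕ) → TDom d (N n) → Wn n → (W n).Φ
  hemb : ∀ n X, ∀ v ∈ ball (0 : Wn n) α₂, emb n X v ∈ (W n).sp2 X
  hcomp : ∀ n X v, EXn n X v = (W n).Ek1 X (emb n X v)
  D : Data190 d M N Wn q
  E2n : (n : ℕ) → TDom d (N n) → TPt d (N n * M) → TPt d (N n * M) → ℝ
  han : ∀ n X, AnalyticOnNhd ℂ (EXn n X) (ball 0 α₂)
  hrepr : ∀ n X x y, E2n n X x y = (mixedDeriv (EXn n X) (D.hn n X x) (D.hn n X y)).re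
  hloc : ∀ (Y : LDom d) (z : Pt d),
    Tendsto (fun n => E2n n (tproj (N n) Y) (proj (N n * M) 0) (proj (N n * M) z)) atTop (𝓝 (a Y z))

/-- The carried `NeZero (N n)` witnesses. [folklore] -/
instance PolLeavesTLoc190.instNeZeroN {M : ℕ} [NeZero M] {a : LDom d → Pt d → ℝ} {c : B13.Consts} {ℓ α₂ : ℝ}
    {q : Consts190} (Lv : PolLeavesTLoc190 d M a c ℓ α₂ q) (n : ℕ) : NeZero (Lv.N n) := Lv.hN n

/-- The carried normed-group structures of the test-vector spaces. [folklore] -/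
instance PolLeavesTLoc190.instNormedAddCommGroupWn {M : ℕ} [NeZero M] {a : LDom d → Pt d → ℝ} {c : B13.Consts}
    {ℓ α₂ : ℝ} {q : Consts190} (Lv : PolLeavesTLoc190 d M a c ℓ α₂ q) (n : ℕ) : NormedAddCommGroup (Lv.Wn n) :=
  Lv.instW n

/-- The carried ℂ-normed-space structures of the test-vector spaces. [folklore] -/
instance PolLeavesTLoc190.instNormedSpaceWn {M : ℕ} [NeZero M] {a : LDom d → Pt d → ℝ} {c : B13.Consts}
    {ℓ α₂ : ℝ} {q : Consts190} (Lv : PolLeavesTLoc190 d M a c ℓ α₂ q) (n : ℕ) : NormedSpace ℂ (Lv.Wn n) :=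
  Lv.instWs n

/-- **The (190)-side data GIVE the torus leaf list with termwise locality** with B₃ := Cκ̄_Bcm (δ₀ ≤ τθ).
[cite: Balaban1987RG1, p.282 and (4.35) p.290; Balaban1985Variational, (190) p.308] -/
def PolLeavesTLoc190.toPolLeavesTLoc {M : ℕ} [NeZero M] {a : LDom d → Pt d → ℝ} {c : B13.Consts} {ℓ α₂ : ℝ}
    {q : Consts190} (Lv : PolLeavesTLoc190 d M a c ℓ α₂ q) (hq : q.Valid c.δ₀) : PolLeavesTLoc d M a c ℓ α₂ q.B₃ where
  N := Lv.N
  hN := Lv.hN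
  hNlim := Lv.hNlim
  W := Lv.W
  hsp := Lv.hsp
  hrep := Lv.hrep
  h238 := Lv.h238
  Wn := Lv.Wn
  instW := Lv.instW
  instWs := Lv.instWs
  EXn := Lv.EXn
  emb := Lv.emb
  hemb := Lv.hemb
  hcomp := Lv.hcomp
  hn := Lv.D.hn
  E2n := Lv.E2n
  han := Lv.han
  hrepr := Lv.hrepr
  hh := Lv.D.hh hq
  hloc := Lv.hloc

/-- **`RemainderLocality.PolLeavesTFac` WITH THE p. 282 LEAF REPLACED BY THE (190)-SIDE DATA** (the printed locality (F1)
and the restricted test-configuration limits (F2), the latter read on the generated test vectors `D.hn`).  A HYPOTHESIS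
structure. [cite: Balaban1987RG1, (1.7) p.261, (1.21) p.264, (4.35) p.290 and p.282; Balaban1988RG2Cluster, (2.38) p.20; Balaban1985Variational, (190) p.308] -/
structure PolLeavesTFac190 (d M : ℕ) [NeZero M] (a : LDom d → Pt d → ℝ) (c : B13.Consts) (ℓ α₂ : ℝ) (q : Consts190)
    where
  N : ℕ → ℕ
  [hN : ∀ n, NeZero (N n)]
  hNlim : Tendsto N atTop atTop
  W : (n : ℕ) → TorusStep d (N n)
  hsp : ∀ n, SpRestr (W n).toStepData (W n).geom
  hrep : ∀ n, Repr213 (W n).toStepData (W n).geom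
  h238 : ∀ n, B13.Bound238With (W n).toStepData c ℓ
  Wn : ℕ → Type
  [instW : ∀ n, NormedAddCommGroup (Wn n)]
  [instWs : ∀ n, NormedSpace ℂ (Wn n)]
  EXn : (n : ℕ) → TDom d (N n) → Wn n → ℂ
  emb : (n : ℕ) → TDom d (N n) → Wn n → (W n).Φ
  hemb : ∀ n X, ∀ v ∈ ball (0 : Wn n) α₂, emb n X v ∈ (W n).sp2 X
  hcomp : ∀ n X v, EXn n X v = (W n).Ek1 X (emb n X v)
  D : Data190 d M N Wn q
  E2n : (n : ℕ) → TDom d (N n) → TPt d (N n * M) → TPt d (N n * M) → ℝ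
  han : ∀ n X, AnalyticOnNhd ℂ (EXn n X) (ball 0 α₂)
  hrepr : ∀ n X x y, E2n n X x y = (mixedDeriv (EXn n X) (D.hn n X x) (D.hn n X y)).re
  V : LDom d → Type
  [instV : ∀ Y, NormedAddCommGroup (V Y)]
  [instVs : ∀ Y, NormedSpace ℂ (V Y)]
  F : (Y : LDom d) → V Y → ℂ
  hF : ∀ Y, AnalyticAt ℂ (F Y) 0
  r : (n : ℕ) → (Y : LDom d) → Wn n →L[ℂ] V Y
  hfac : ∀ Y : LDom d, ∀ᶠ n in atTop, ∀ v ∈ ball (0 : Wn n) α₂, EXn n (tproj (N n) Y) v = F Y (r n Y v)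
  t : (Y : LDom d) → Pt d → V Y
  hconv : ∀ (Y : LDom d) (x : Pt d),
    Tendsto (fun n => r n Y (D.hn n (tproj (N n) Y) (proj (N n * M) x))) atTop (𝓝 (t Y x))
  ha : ∀ (Y : LDom d) (z : Pt d), a Y z = (mixedDeriv (F Y) (t Y 0) (t Y z)).re

/-- The carried `NeZero (N n)` witnesses. [folklore] -/
instance PolLeavesTFac190.instNeZeroN {M : ℕ} [NeZero M] {a : LDom d → Pt d → ℝ} {c : B13.Consts} {ℓ α₂ : ℝ}
    {q : Consts190} (Lv : PolLeavesTFac190 d M a c ℓ α₂ q) (n : ℕ) : NeZero (Lv.N n) := Lv.hN n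

/-- The carried normed-group structures of the test-vector spaces. [folklore] -/
instance PolLeavesTFac190.instNormedAddCommGroupWn {M : ℕ} [NeZero M] {a : LDom d → Pt d → ℝ} {c : B13.Consts}
    {ℓ α₂ : ℝ} {q : Consts190} (Lv : PolLeavesTFac190 d M a c ℓ α₂ q) (n : ℕ) : NormedAddCommGroup (Lv.Wn n) :=
  Lv.instW n

/-- The carried ℂ-normed-space structures of the test-vector spaces. [folklore] -/
instance PolLeavesTFac190.instNormedSpaceWn {M : ℕ} [NeZero M] {a : LDom d → Pt d → ℝ} {c : B13.Consts}
    {ℓ α₂ : ℝ} {q : Consts190} (Lv : PolLeavesTFac190 d M a c ℓ α₂ q) (n : ℕ) : NormedSpace ℂ (Lv.Wn n) :=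
  Lv.instWs n

/-- The carried normed-group structures of the restricted-configuration spaces. [folklore] -/
instance PolLeavesTFac190.instNormedAddCommGroupV {M : ℕ} [NeZero M] {a : LDom d → Pt d → ℝ} {c : B13.Consts}
    {ℓ α₂ : ℝ} {q : Consts190} (Lv : PolLeavesTFac190 d M a c ℓ α₂ q) (Y : LDom d) : NormedAddCommGroup (Lv.V Y) :=
  Lv.instV Y

/-- The carried ℂ-normed-space structures of the restricted-configuration spaces. [folklore] -/
instance PolLeavesTFac190.instNormedSpaceV {M : ℕ} [NeZero M] {a : LDom d → Pt d → ℝ} {c : B13.Consts} {ℓ α₂ : ℝ}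
    {q : Consts190} (Lv : PolLeavesTFac190 d M a c ℓ α₂ q) (Y : LDom d) : NormedSpace ℂ (Lv.V Y) := Lv.instVs Y

/-- **The (190)-side data GIVE the torus leaf list with (1.7)-factorization** with B₃ := Cκ̄_Bcm (δ₀ ≤ τθ).
[cite: Balaban1987RG1, p.282, (1.7) p.261 and (4.35) p.290; Balaban1985Variational, (190) p.308] -/
def PolLeavesTFac190.toPolLeavesTFac {M : ℕ} [NeZero M] {a : LDom d → Pt d → ℝ} {c : B13.Consts} {ℓ α₂ : ℝ}
    {q : Consts190} (Lv : PolLeavesTFac190 d M a c ℓ α₂ q) (hq : q.Valid c.δ₀) : PolLeavesTFac d M a c ℓ α₂ q.B₃ where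
  N := Lv.N
  hN := Lv.hN
  hNlim := Lv.hNlim
  W := Lv.W
  hsp := Lv.hsp
  hrep := Lv.hrep
  h238 := Lv.h238
  Wn := Lv.Wn
  instW := Lv.instW
  instWs := Lv.instWs
  EXn := Lv.EXn
  emb := Lv.emb
  hemb := Lv.hemb
  hcomp := Lv.hcomp
  hn := Lv.D.hn
  E2n := Lv.E2n
  han := Lv.han
  hrepr := Lv.hrepr
  hh := Lv.D.hh hq
  V := Lv.V
  instV := Lv.instV
  instVs := Lv.instVs
  F := Lv.F
  hF := Lv.hF
  r := Lv.r
  hfac := Lv.hfac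
  t := Lv.t
  hconv := Lv.hconv
  ha := Lv.ha

/-! ## 4. The chains and the k-UNIFORM bound — the SAME closed coefficient at B₃ := Cκ̄_Bcm -/

section Chain

variable {M : ℕ} [NeZero M]

/-- **THE REMAINDER CHAIN ON THE PERIODIC CARRIER WITH THE (190)-SIDE DATA** (the twin of `RemainderChainTorus.ChainT`):
the (5.1)-limit kernels `P1 k p`, the dictionary clause (1.20)/(1.22) `beta1_eq`, and for every scale k and history p in
the box the leaf list `PolLeavesT190` — ONE `c, ℓ, α₂, M` AND ONE (190)-CONSTANT RECORD `q` for all k, p (the constants of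
[15] Sect. G are uniform in the step).  A HYPOTHESIS structure. [cite: Balaban1987RG1, (1.20)-(1.22) p.264; Balaban1988RG2Cluster, (2.38) p.20; Balaban1985Variational, (190) p.308] -/
structure ChainT190 (d M : ℕ) [NeZero M] (μ ν : Fin d) {β : HBeta} (S : B12Beta.OneLoopSplit β) (γ : ℝ)
    (c : B13.Consts) (ℓ α₂ : ℝ) (q : Consts190) where
  P1 : (k : ℕ) → (Fin (k + 1) → ℝ) → B12Beta.Kernel d
  beta1_eq : ∀ k p, p ∈ B12Beta.HistBox γ k → S.β1 k p = B12Beta.secondMoment (P1 k p) μ ν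
  leaves : ∀ k p, p ∈ B12Beta.HistBox γ k → PolLeavesT190 d M (P1 k p μ ν) c ℓ α₂ q

variable {μ ν : Fin d} {β : HBeta} {S : B12Beta.OneLoopSplit β} {γ : ℝ} {c : B13.Consts} {ℓ α₂ : ℝ}
  {q : Consts190}

/-- A chain with the (190)-side data IS a torus chain of `RemainderChainTorus` at B₃ := Cκ̄_Bcm. [folklore] -/
def ChainT190.toChainT (R : ChainT190 d M μ ν S γ c ℓ α₂ q) (hq : q.Valid c.δ₀) : ChainT d M μ ν S γ c ℓ α₂ q.B₃ where
  P1 := R.P1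
  beta1_eq := R.beta1_eq
  leaves := fun k p hp => (R.leaves k p hp).toPolLeavesT hq

/-- **THE k-UNIFORM REMAINDER BOUND WITH THE p. 282 LEAF DERIVED FROM (190), coefficient FULLY VALUED**:
`|β¹_{k+1}(g_0,…,g_k)| ≤ ε₁ · K_rem,L(d, M, c, α₂, Cκ̄_Bcm)` for EVERY scale k and EVERY history in `]0,γ]^{k+1}` — the
closed formula `RemainderChainLattice.remCoeffL` of `ChainT.abs_beta1_le` at B₃ := Cκ̄_Bcm.  O(ε₁), not O(g_k), not O(γ²).
[cite: Balaban1988RG2Cluster, (2.38) p.20; Balaban1987RG1, (5.10) p.293 and (1.22) p.264; Balaban1985Variational, (190) p.308] -/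
theorem ChainT190.abs_beta1_le (R : ChainT190 d M μ ν S γ c ℓ α₂ q) (hC : CondsL d c ℓ) (h22 : c.R22gen ℓ)
    (hq : q.Valid c.δ₀) (hs : SignsL c α₂ q.B₃) (hd : 0 < d) : RemainderConst S γ (c.ε₁ * remCoeffL d M c α₂ q.B₃) :=
  (R.toChainT hq).abs_beta1_le hC h22 hs hd

/-- The one-sided form `−ε₁K_rem,L ≤ β¹_{k+1}` on the boxes. [folklore] -/
theorem ChainT190.neg_le_beta1 (R : ChainT190 d M μ ν S γ c ℓ α₂ q) (hC : CondsL d c ℓ) (h22 : c.R22gen ℓ)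
    (hq : q.Valid c.δ₀) (hs : SignsL c α₂ q.B₃) (hd : 0 < d) :
    ∀ k (p : Fin (k + 1) → ℝ), p ∈ B12Beta.HistBox γ k → -(c.ε₁ * remCoeffL d M c α₂ q.B₃) ≤ S.β1 k p :=
  (R.toChainT hq).neg_le_beta1 hC h22 hs hd

/-- **The same bound with the sign record assembled from the printed signs** (C₃ε₁ ≥ 0, α₂ > 0, δ₀ > 0; B₃ ≥ 0 derived).
[cite: Balaban1988RG2Cluster, (2.38) p.20; Balaban1987RG1, (5.10) p.293; Balaban1985Variational, (190) p.308] -/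
theorem ChainT190.abs_beta1_le' (R : ChainT190 d M μ ν S γ c ℓ α₂ q) (hC : CondsL d c ℓ) (h22 : c.R22gen ℓ)
    (hq : q.Valid c.δ₀) (hA : 0 ≤ c.C3act * c.ε₁) (hα₂ : 0 < α₂) (hδ₀ : 0 < c.δ₀) (hd : 0 < d) :
    RemainderConst S γ (c.ε₁ * remCoeffL d M c α₂ q.B₃) :=
  R.abs_beta1_le hC h22 hq (hq.signsL hA hα₂ hδ₀) hd

/-- **THE REMAINDER CHAIN WITH (1.7)-FACTORIZATION AND THE (190)-SIDE DATA** (the twin of `RemainderLocality.ChainTFac`).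
A HYPOTHESIS structure. [cite: Balaban1987RG1, (1.20)-(1.22) p.264 and (1.7) p.261; Balaban1988RG2Cluster, (2.38) p.20; Balaban1985Variational, (190) p.308] -/
structure ChainTFac190 (d M : ℕ) [NeZero M] (μ ν : Fin d) {β : HBeta} (S : B12Beta.OneLoopSplit β) (γ : ℝ)
    (c : B13.Consts) (ℓ α₂ : ℝ) (q : Consts190) where
  A1 : (k : ℕ) → (Fin (k + 1) → ℝ) → LDom d → Pt d → ℝ
  beta1_eq : ∀ k p, p ∈ B12Beta.HistBox γ k →
    S.β1 k p = B12Beta.secondMoment (fun _ _ => limKernel (A1 k p)) μ ν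
  leaves : ∀ k p, p ∈ B12Beta.HistBox γ k → PolLeavesTFac190 d M (A1 k p) c ℓ α₂ q

/-- A chain with (1.7)-factorization and the (190)-side data IS a chain of `RemainderLocality` at B₃ := Cκ̄_Bcm. [folklore] -/
def ChainTFac190.toChainTFac (R : ChainTFac190 d M μ ν S γ c ℓ α₂ q) (hq : q.Valid c.δ₀) :
    ChainTFac d M μ ν S γ c ℓ α₂ q.B₃ where
  A1 := R.A1
  beta1_eq := R.beta1_eq
  leaves := fun k p hp => (R.leaves k p hp).toPolLeavesTFac hq

/-- **THE k-UNIFORM REMAINDER BOUND WITH (5.1) DERIVED FROM THE PRINTED LOCALITY AND THE p. 282 LEAF DERIVED FROM (190)**,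
coefficient FULLY VALUED AND IDENTICAL TO `ChainT190.abs_beta1_le`'s: `|β¹_{k+1}| ≤ ε₁ · K_rem,L(d, M, c, α₂, Cκ̄_Bcm)` for
EVERY scale and EVERY history in the box. [cite: Balaban1988RG2Cluster, (2.38) p.20; Balaban1987RG1, (5.10) p.293, (1.22) p.264 and (1.7) p.261; Balaban1985Variational, (190) p.308] -/
theorem ChainTFac190.abs_beta1_le (R : ChainTFac190 d M μ ν S γ c ℓ α₂ q) (hC : CondsL d c ℓ) (h22 : c.R22gen ℓ)
    (hq : q.Valid c.δ₀) (hs : SignsL c α₂ q.B₃) (hd : 0 < d) : RemainderConst S γ (c.ε₁ * remCoeffL d M c α₂ q.B₃) :=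
  (R.toChainTFac hq).abs_beta1_le hC h22 hs hd

/-- The one-sided form on the boxes. [folklore] -/
theorem ChainTFac190.neg_le_beta1 (R : ChainTFac190 d M μ ν S γ c ℓ α₂ q) (hC : CondsL d c ℓ) (h22 : c.R22gen ℓ)
    (hq : q.Valid c.δ₀) (hs : SignsL c α₂ q.B₃) (hd : 0 < d) :
    ∀ k (p : Fin (k + 1) → ℝ), p ∈ B12Beta.HistBox γ k → -(c.ε₁ * remCoeffL d M c α₂ q.B₃) ≤ S.β1 k p :=
  (R.toChainTFac hq).neg_le_beta1 hC h22 hs hd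

/-! ### The RULING (R10) END consumers, by name -/

/-- **`BetaPartialSumsLowerH` from telescoping + the chain with (1.7)-factorization and the (190)-side data**
(`RemainderLocality.betaPartialSumsLowerH_of_telescope_chainTFac` ∘ `toChainTFac`). [cite: Balaban1987RG1, Thm 2 p.259 (first sentence); Balaban1988RG2Cluster, (2.38) p.20; Balaban1985Variational, (190) p.308] -/
theorem betaPartialSumsLowerH_of_telescope_chainTFac190 {γ₀ b A : ℝ} {B : ℕ → ℝ} {L : ℕ}
    (R : ChainTFac190 d M μ ν S γ₀ c ℓ α₂ q) (hC : CondsL d c ℓ) (h22 : c.R22gen ℓ) (hq : q.Valid c.δ₀)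
    (hs : SignsL c α₂ q.B₃) (hd : 0 < d) (hL : 2 ≤ L) (hA : 0 ≤ A)
    (hTel : ∀ k : ℕ, ∑ j ∈ Finset.range k, S.β0 j = B (L ^ k)) (hB : ∀ n : ℕ, 2 ≤ n → |B n - b * Real.log n| ≤ A)
    (hε₁ : c.ε₁ * remCoeffL d M c α₂ q.B₃ ≤ b * Real.log L) : BetaPartialSumsLowerH (2 * A) γ₀ β :=
  betaPartialSumsLowerH_of_telescope_chainTFac (R.toChainTFac hq) hC h22 hs hd hL hA hTel hB hε₁

/-- **ENDPOINT EXISTENCE from telescoping + the chain with (1.7)-factorization and the (190)-side data**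
(`RemainderLocality.endpointExistence_of_telescope_chainTFac` ∘ `toChainTFac`). [cite: Balaban1987RG1, Thm 2 p.259 (first sentence); Balaban1988RG2Cluster, (2.38) p.20; Balaban1985Variational, (190) p.308] -/
theorem endpointExistence_of_telescope_chainTFac190 {C : B12.Construction} (hgen : ForwardGenerated C β)
    {γ₀ b A β' : ℝ} {B : ℕ → ℝ} {L : ℕ} (R : ChainTFac190 d M μ ν S γ₀ c ℓ α₂ q) (hC : CondsL d c ℓ)
    (h22 : c.R22gen ℓ) (hq : q.Valid c.δ₀) (hs : SignsL c α₂ q.B₃) (hd : 0 < d) (hγ₀ : 0 < γ₀) (hL : 2 ≤ L)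
    (hA : 0 ≤ A) (hTel : ∀ k : ℕ, ∑ j ∈ Finset.range k, S.β0 j = B (L ^ k))
    (hB : ∀ n : ℕ, 2 ≤ n → |B n - b * Real.log n| ≤ A) (hε₁ : c.ε₁ * remCoeffL d M c α₂ q.B₃ ≤ b * Real.log L)
    (hβ' : 0 ≤ β') (hcont : BetaContH γ₀ β) (hup : BetaUpperH β' γ₀ β) : EndpointExistence C :=
  endpointExistence_of_telescope_chainTFac hgen (R.toChainTFac hq) hC h22 hs hd hγ₀ hL hA hTel hB hε₁ hβ' hcont hup

/-- **ENDPOINT EXISTENCE from telescoping + the plain torus chain with the (190)-side data**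
(`RemainderChainTorus.endpointExistence_of_telescope_chainT` ∘ `toChainT`). [cite: Balaban1987RG1, Thm 2 p.259 (first sentence); Balaban1988RG2Cluster, (2.38) p.20; Balaban1985Variational, (190) p.308] -/
theorem endpointExistence_of_telescope_chainT190 {C : B12.Construction} (hgen : ForwardGenerated C β)
    {γ₀ b A β' : ℝ} {B : ℕ → ℝ} {L : ℕ} (R : ChainT190 d M μ ν S γ₀ c ℓ α₂ q) (hC : CondsL d c ℓ)
    (h22 : c.R22gen ℓ) (hq : q.Valid c.δ₀) (hs : SignsL c α₂ q.B₃) (hd : 0 < d) (hγ₀ : 0 < γ₀) (hL : 2 ≤ L)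
    (hA : 0 ≤ A) (hTel : ∀ k : ℕ, ∑ j ∈ Finset.range k, S.β0 j = B (L ^ k))
    (hB : ∀ n : ℕ, 2 ≤ n → |B n - b * Real.log n| ≤ A) (hε₁ : c.ε₁ * remCoeffL d M c α₂ q.B₃ ≤ b * Real.log L)
    (hβ' : 0 ≤ β') (hcont : BetaContH γ₀ β) (hup : BetaUpperH β' γ₀ β) : EndpointExistence C :=
  endpointExistence_of_telescope_chainT hgen (R.toChainT hq) hC h22 hs hd hγ₀ hL hA hTel hB hε₁ hβ' hcont hup

end Chain

end

end Literature.MathematicalPhysics.QuantumFieldTheory.Balaban1983to89.Beta.RemainderDecay190
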